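import Literature.NumberTheory.LFunctions.Zhang2022.AppendixALemma83PowSum
import Literature.NumberTheory.LFunctions.Zhang2022.AppendixALemma83Discharge
import Literature.NumberTheory.LFunctions.Zhang2022.RepairGapAppendixALocalFree
import HarnessLib

/-!
# Zhang (2022), rescue GAP/BED (D-0124 (3)(4)): Appendix A Cases 2 and 3 — Z22:§A.u017, Z22:§A.u019,
# (A.2) and (A.3) GUARD-FREE

Topic `Literature/NumberTheory/LFunctions/Zhang2022` (Landau–Siegel audit tree; verdict-neutral).
Y. Zhang, *Discrete mean estimates and the Landau–Siegel zero*, arXiv:2211.02515v1 (2022)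
[Zhang2022LandauSiegel] — **an unrefereed manuscript under adjudication; nothing in this file asserts or
denies its Theorems 1–2, and nothing here is a claim about Landau–Siegel zeros. The programme SEARCHES and
TYPES; no claim about Landau–Siegel zeros, Theorems 1–2 of arXiv:2211.02515 or a repaired Margin232 until a
kernel theorem says so.**

The typed campaign nodes of Cases 2 (`q ∣ h`) and 3 (`q ∣ d`, `(q,h) = 1`) of the printed proof of Lemma 8.3 —
`Typed.AppendixA1.StepA_u017` (App. A p. 103, tex L5066), `StepA_u019` (tex L5081) and the displays **(A.2)**
`EqA_2` / **(A.3)** `EqA_3` (tex L5011 / L5015, via the deductions `DedA2` / `DedA3`) — are typed under the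
standing guard `AssumptionA D χ →`, which their tree proofs (`Lemma83.stepA_u017_holds`, `stepA_u019_holds`,
`dedA2_holds`, `dedA3_holds`, file `AppendixALemma83PowSum`) never use. This file re-runs those proofs VERBATIM
with the guard binder deleted: `stepA_u017_free` (`C = 2600`), `stepA_u019_free` (`C = 6700`), and
`eqA_2_free` / `eqA_3_free` = the bodies of `dedA2_holds` / `dedA3_holds` fed with the guard-free inputs and
`stepA_u015_free` (file `RepairGapAppendixALocalFree`); the `λ̃ = 1` facts `stepA_u017_lamTilde_holds` /
`stepA_u018_lamTilde_holds` are guard-free in the tree already. Second input layer of the guard-free Lemma 8.3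
(relative) chain (rescue GAP row G-31; target: the Lemma 8.4 leaf at (A)-exponent 15 unconditional through
`Lemma84.lemma84Rel_pow15_of_lemma83Rel_pow15`). Theorems only; no definition, no named fact; nothing about
(A) itself. Private series helpers copied unchanged from the tree file; the public per-`(D,q)` engines
(`frame_X`, `frame_t`, `xiPowSum_eq`, `case3_coeff_bound`, `norm_cpow_neg_betaJ_sub_one_le`) are the tree's.

## References

* Y. Zhang, arXiv:2211.02515v1 (2022), Appendix A pp. 102–103. [cite: Zhang2022LandauSiegel, App. A]
-/

noncomputable section

open Complex Real ComplexConjugate Finset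

namespace Literature.NumberTheory.LFunctions.Zhang2022.Repair.Gap

open Literature.NumberTheory.LFunctions.Zhang2022
open Literature.NumberTheory.LFunctions.Zhang2022.Skeleton
open Literature.NumberTheory.LFunctions.Zhang2022.MeanSquareMajorant
open Literature.NumberTheory.LFunctions.Zhang2022.Typed.AppendixA1
open Literature.NumberTheory.LFunctions.Zhang2022.Lemma83

/-! ## Private series helpers (copied from `AppendixALemma83PowSum`) -/

/-- `Σ_{r≥0} Z^{r+1} = 1/(1−Z) − 1` for `‖Z‖ < 1`. [folklore] -/
private theorem hasSum_pow_succ {Z : ℂ} (hZ : ‖Z‖ < 1) :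
    HasSum (fun r : ℕ => Z ^ (r + 1)) (1 / (1 - Z) - 1) := by
  have h1 : 1 - Z ≠ 0 := sub_ne_zero.mpr (fun h => by rw [← h, norm_one] at hZ; exact lt_irrefl _ hZ)
  have h := (hasSum_geometric_of_norm_lt_one hZ).mul_left Z
  simp only [← pow_succ'] at h
  have e : Z * (1 - Z)⁻¹ = 1 / (1 - Z) - 1 := by field_simp; ring
  rwa [e] at h

/-- `Σ_{r≥0} (r+1)Z^{r+1} = Z/(1−Z)²` for `‖Z‖ < 1`. [folklore] -/
private theorem hasSum_coe_succ_mul_pow_succ {Z : ℂ} (hZ : ‖Z‖ < 1) :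
    HasSum (fun r : ℕ => ((r : ℂ) + 1) * Z ^ (r + 1)) (Z / (1 - Z) ^ 2) := by
  have h := hasSum_coe_mul_geometric_of_norm_lt_one hZ
  rw [← hasSum_nat_add_iff' 1] at h
  simp only [Finset.range_one, Finset.sum_singleton, Nat.cast_zero, zero_mul, sub_zero,
    Nat.cast_add, Nat.cast_one] at h
  exact h

/-- `Σ_{r≥0} (r+2)Z^{r+1} = 1/(1−Z)² − 1` for `‖Z‖ < 1`. [folklore] -/
private theorem hasSum_coe_add_two_mul_pow_succ {Z : ℂ} (hZ : ‖Z‖ < 1) :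
    HasSum (fun r : ℕ => ((r : ℂ) + 2) * Z ^ (r + 1)) (1 / (1 - Z) ^ 2 - 1) := by
  have h1 : 1 - Z ≠ 0 := sub_ne_zero.mpr (fun h => by rw [← h, norm_one] at hZ; exact lt_irrefl _ hZ)
  have h := (hasSum_coe_succ_mul_pow_succ hZ).add (hasSum_pow_succ hZ)
  have e : Z / (1 - Z) ^ 2 + (1 / (1 - Z) - 1) = 1 / (1 - Z) ^ 2 - 1 := by field_simp; ring
  rw [e] at h
  convert h using 1
  ext r; ring

/-- `(r+2)² ≤ 9·(3/2)^r`. [folklore] -/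
private theorem sq_le_nine_mul_pow (r : ℕ) : ((r : ℝ) + 2) ^ 2 ≤ 9 * (3 / 2 : ℝ) ^ r := by
  have step : ∀ n : ℕ, 3 ≤ n → ((n : ℝ) + 2) ^ 2 ≤ 9 * (3 / 2 : ℝ) ^ n →
      (((n + 1 : ℕ) : ℝ) + 2) ^ 2 ≤ 9 * (3 / 2 : ℝ) ^ (n + 1) := by
    intro n hn ih
    have hn' : (3 : ℝ) ≤ n := by exact_mod_cast hn
    have key : ((n : ℝ) + 1 + 2) ^ 2 ≤ (3 / 2) * ((n : ℝ) + 2) ^ 2 := by nlinarith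
    calc (((n + 1 : ℕ) : ℝ) + 2) ^ 2 = ((n : ℝ) + 1 + 2) ^ 2 := by push_cast; ring
      _ ≤ (3 / 2) * ((n : ℝ) + 2) ^ 2 := key
      _ ≤ (3 / 2) * (9 * (3 / 2 : ℝ) ^ n) := by gcongr
      _ = 9 * (3 / 2 : ℝ) ^ (n + 1) := by ring
  rcases Nat.lt_or_ge r 3 with hr | hr
  · interval_cases r <;> norm_num
  · induction r, hr using Nat.le_induction with
    | base => norm_num
    | succ n hn ih => exact step n hn ih

/-- Weighted power sums with polynomially controlled coefficients: if `‖Z‖ ≤ 3/5` and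
`‖f(r)‖ ≤ E(r+2)²` then `Σ_r Z^{r+1}f(r)` converges absolutely and is `≤ 90E‖Z‖` in norm.
[folklore] -/
private theorem tsum_pow_succ_mul_bound {Z : ℂ} (hZ : ‖Z‖ ≤ 3 / 5) {f : ℕ → ℂ} {E : ℝ}
    (hE : 0 ≤ E) (hf : ∀ r : ℕ, ‖f r‖ ≤ E * ((r : ℝ) + 2) ^ 2) :
    Summable (fun r : ℕ => Z ^ (r + 1) * f r) ∧ ‖∑' r : ℕ, Z ^ (r + 1) * f r‖ ≤ 90 * E * ‖Z‖ := by
  have hterm : ∀ r : ℕ, ‖Z ^ (r + 1) * f r‖ ≤ 9 * E * ‖Z‖ * (9 / 10 : ℝ) ^ r := fun r => by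
    rw [norm_mul, norm_pow, pow_succ]
    have h1 : ‖Z‖ ^ r ≤ (3 / 5 : ℝ) ^ r := pow_le_pow_left₀ (norm_nonneg _) hZ r
    have h2 := sq_le_nine_mul_pow r
    calc ‖Z‖ ^ r * ‖Z‖ * ‖f r‖ ≤ (3 / 5 : ℝ) ^ r * ‖Z‖ * (E * ((r : ℝ) + 2) ^ 2) := by
          gcongr; exact hf r
      _ ≤ (3 / 5 : ℝ) ^ r * ‖Z‖ * (E * (9 * (3 / 2 : ℝ) ^ r)) := by gcongr
      _ = 9 * E * ‖Z‖ * ((3 / 5 : ℝ) ^ r * (3 / 2) ^ r) := by ring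
      _ = 9 * E * ‖Z‖ * (9 / 10 : ℝ) ^ r := by rw [← mul_pow]; norm_num
  have hgeo : HasSum (fun r : ℕ => 9 * E * ‖Z‖ * (9 / 10 : ℝ) ^ r) (9 * E * ‖Z‖ * 10) := by
    have h := (hasSum_geometric_of_lt_one (by norm_num : (0 : ℝ) ≤ 9 / 10) (by norm_num)).mul_left
      (9 * E * ‖Z‖)
    have e : 9 * E * ‖Z‖ * (1 - 9 / 10 : ℝ)⁻¹ = 9 * E * ‖Z‖ * 10 := by norm_num
    rwa [e] at h
  have hsum : Summable (fun r : ℕ => Z ^ (r + 1) * f r) :=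
    Summable.of_norm_bounded hgeo.summable hterm
  refine ⟨hsum, ?_⟩
  calc ‖∑' r : ℕ, Z ^ (r + 1) * f r‖ ≤ 9 * E * ‖Z‖ * 10 := tsum_of_norm_bounded hgeo hterm
    _ = 90 * E * ‖Z‖ := by ring

/-- `‖1/(1−a) − 1/(1−b)‖ ≤ (25/4)‖a − b‖` for `‖a‖, ‖b‖ ≤ 3/5`. [folklore] -/
private theorem norm_inv_sub_inv_le {a b : ℂ} (ha : ‖a‖ ≤ 3 / 5) (hb : ‖b‖ ≤ 3 / 5) :
    ‖1 / (1 - a) - 1 / (1 - b)‖ ≤ 25 / 4 * ‖a - b‖ := by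
  have hna : 2 / 5 ≤ ‖1 - a‖ := by
    linarith [norm_le_norm_add_norm_sub' (1 : ℂ) a, norm_one (α := ℂ)]
  have hnb : 2 / 5 ≤ ‖1 - b‖ := by
    linarith [norm_le_norm_add_norm_sub' (1 : ℂ) b, norm_one (α := ℂ)]
  have ha0 : 1 - a ≠ 0 := fun h => by rw [h, norm_zero] at hna; linarith
  have hb0 : 1 - b ≠ 0 := fun h => by rw [h, norm_zero] at hnb; linarith
  have e : 1 / (1 - a) - 1 / (1 - b) = (a - b) / ((1 - a) * (1 - b)) := by field_simp; ring
  rw [e, norm_div, norm_mul]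
  rw [div_le_iff₀ (by positivity)]
  nlinarith [norm_nonneg (a - b), mul_le_mul hna hnb (by norm_num) (norm_nonneg _)]

/-- `‖1/(1−a)² − 1/(1−b)²‖ ≤ 125‖a − b‖` for `‖a‖, ‖b‖ ≤ 3/5`. [folklore] -/
private theorem norm_inv_sq_sub_inv_sq_le {a b : ℂ} (ha : ‖a‖ ≤ 3 / 5) (hb : ‖b‖ ≤ 3 / 5) :
    ‖1 / (1 - a) ^ 2 - 1 / (1 - b) ^ 2‖ ≤ 125 * ‖a - b‖ := by
  have hna : 2 / 5 ≤ ‖1 - a‖ := by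
    linarith [norm_le_norm_add_norm_sub' (1 : ℂ) a, norm_one (α := ℂ)]
  have hnb : 2 / 5 ≤ ‖1 - b‖ := by
    linarith [norm_le_norm_add_norm_sub' (1 : ℂ) b, norm_one (α := ℂ)]
  have ha0 : 1 - a ≠ 0 := fun h => by rw [h, norm_zero] at hna; linarith
  have hb0 : 1 - b ≠ 0 := fun h => by rw [h, norm_zero] at hnb; linarith
  have e : 1 / (1 - a) ^ 2 - 1 / (1 - b) ^ 2 =
      (a - b) * (2 - a - b) / ((1 - a) ^ 2 * (1 - b) ^ 2) := by field_simp; ring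
  have h2ab : ‖2 - a - b‖ ≤ 16 / 5 := by
    calc ‖2 - a - b‖ ≤ ‖(2 : ℂ) - a‖ + ‖b‖ := norm_sub_le _ _
      _ ≤ ‖(2 : ℂ)‖ + ‖a‖ + ‖b‖ := by linarith [norm_sub_le (2 : ℂ) a]
      _ ≤ 16 / 5 := by rw [Complex.norm_two]; linarith
  have hden : (2 / 5 : ℝ) ^ 2 * (2 / 5) ^ 2 ≤ ‖1 - a‖ ^ 2 * ‖1 - b‖ ^ 2 :=
    mul_le_mul (pow_le_pow_left₀ (by norm_num) hna 2) (pow_le_pow_left₀ (by norm_num) hnb 2)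
      (by positivity) (by positivity)
  rw [e, norm_div, norm_mul, norm_mul, norm_pow, norm_pow, div_le_iff₀ (by positivity)]
  nlinarith [norm_nonneg (a - b), mul_le_mul_of_nonneg_left h2ab (norm_nonneg (a - b))]

/-- `‖a/(1−a)² − b/(1−b)²‖ ≤ 82‖a − b‖` for `‖a‖, ‖b‖ ≤ 3/5`. [folklore] -/
private theorem norm_div_sq_sub_div_sq_le {a b : ℂ} (ha : ‖a‖ ≤ 3 / 5) (hb : ‖b‖ ≤ 3 / 5) :
    ‖a / (1 - a) ^ 2 - b / (1 - b) ^ 2‖ ≤ 82 * ‖a - b‖ := by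
  have hna : 2 / 5 ≤ ‖1 - a‖ := by
    linarith [norm_le_norm_add_norm_sub' (1 : ℂ) a, norm_one (α := ℂ)]
  have ha0 : 1 - a ≠ 0 := fun h => by rw [h, norm_zero] at hna; linarith
  have e : a / (1 - a) ^ 2 - b / (1 - b) ^ 2 =
      (a - b) * (1 / (1 - a) ^ 2) + b * (1 / (1 - a) ^ 2 - 1 / (1 - b) ^ 2) := by
    ring
  have hinv : ‖1 / (1 - a) ^ 2‖ ≤ 25 / 4 := by
    rw [norm_div, norm_one, norm_pow, div_le_iff₀ (by positivity)]
    nlinarith [pow_le_pow_left₀ (by norm_num : (0:ℝ) ≤ 2 / 5) hna 2]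
  rw [e]
  calc _ ≤ ‖(a - b) * (1 / (1 - a) ^ 2)‖ + ‖b * (1 / (1 - a) ^ 2 - 1 / (1 - b) ^ 2)‖ :=
        norm_add_le _ _
    _ ≤ ‖a - b‖ * (25 / 4) + 3 / 5 * (125 * ‖a - b‖) := by
        rw [norm_mul, norm_mul]
        exact add_le_add (mul_le_mul_of_nonneg_left hinv (norm_nonneg _))
          (mul_le_mul hb (norm_inv_sq_sub_inv_sq_le ha hb) (norm_nonneg _) (by norm_num))
    _ ≤ 82 * ‖a - b‖ := by nlinarith [norm_nonneg (a - b)]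

/-! ## Z22:§A.u017 guard-free (Case 2) -/

/-- **Z22:§A.u017, GUARD-FREE** (App. A p. 103, tex L5066; twin of `Lemma83.stepA_u017_holds` with the unused binder
`AssumptionA D χ` deleted): for `q ∣ h`, `|s − 1| < 5α`, `q < D`, `(q,D) = 1`:
`‖Σ_r χ(q^r)ξ_j(q^r;d,h)/q^{rs} − (1/(1−vu)² − 1)‖ ≤ 2600·α log q/q`, all `D ≥ exp(10|c′|π + 400)`, every real
primitive `χ` — no hypothesis on `L(1,χ)`. [cite: Zhang2022LandauSiegel, App. A p. 103] -/
theorem stepA_u017_free (c' : ℝ) :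
    ∃ C : ℝ, ForAllLarge fun D _ χ => ∀ j ∈ ({1, 2, 3} : Finset ℕ), ∀ d h : ℕ,
      1 ≤ d → 1 ≤ h → ((d * h : ℕ) : ℝ) < bigP D / bigT D ^ 2 → ∀ q : ℕ, q.Prime → ∀ s : ℂ,
        CondA9 D s q → q ∣ h →
          ‖xiPowSum c' χ j d h s q - (1 / (1 - vA χ q * uA q) ^ 2 - 1)‖
            ≤ C * (alpha D * Real.log q / q) := by
  refine ⟨2600, ⌈Real.exp (10 * |c'| * π + 400)⌉₊,
    fun D _ χ hD _ _ j _ d h hd hh _ q hq s hcond hqh => ?_⟩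
  have hD' : Real.exp (10 * |c'| * π + 400) ≤ D := le_trans (Nat.le_ceil _) (by exact_mod_cast hD)
  obtain ⟨hℓ3, hα, hB, hαℓ⟩ := largeD_bounds c' hD'
  obtain ⟨hs, hqD, _⟩ := hcond
  obtain ⟨hXu, hXn, hun, hqinv, hlogq, hlogq0⟩ := frame_X c' hD' hq hqD hs
  set B : ℝ := |b1 c' D| + |b2 c' D| + |b3 c' D| with hBdef
  set v : ℂ := χ (q : ZMod D) with hv
  set X : ℂ := (q : ℂ) ^ (-s) with hX
  set u : ℂ := ((q : ℂ))⁻¹ with hu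
  have hvn : ‖v‖ ≤ 1 := χ.norm_le_one _
  have hvX : ‖v * X‖ ≤ 3 / 5 := by
    rw [norm_mul]; nlinarith [norm_nonneg v, norm_nonneg X]
  have hvu : ‖v * u‖ ≤ 3 / 5 := by
    rw [norm_mul]; nlinarith [norm_nonneg v, norm_nonneg u]
  have hvXu : ‖v * X - v * u‖ ≤ 10 * alpha D * Real.log q * (q : ℝ)⁻¹ := by
    rw [← mul_sub, norm_mul]; nlinarith [norm_nonneg v, norm_nonneg (X - u)]
  have hvX2 : ‖v * X‖ ≤ 2 * (q : ℝ)⁻¹ := by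
    have h1 : ‖X‖ ≤ ‖X - u‖ + ‖u‖ := by
      have := norm_add_le (X - u) u; rwa [sub_add_cancel] at this
    have h2 : ‖u‖ = (q : ℝ)⁻¹ := by rw [hu, norm_inv, Complex.norm_natCast]
    have h3 : 10 * alpha D * Real.log q * (q : ℝ)⁻¹ ≤ (q : ℝ)⁻¹ := by
      have : 10 * alpha D * Real.log q ≤ 10 * (alpha D * ell D) := by
        calc _ ≤ 10 * alpha D * ell D := by gcongr
          _ = _ := by ring
      have hq0' : (0 : ℝ) ≤ (q : ℝ)⁻¹ := by positivity
      nlinarith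
    calc ‖v * X‖ ≤ ‖X‖ := by rw [norm_mul]; nlinarith [norm_nonneg v, norm_nonneg X]
      _ ≤ 2 * (q : ℝ)⁻¹ := by linarith
  -- the coefficients: `ξ_j(q^{r+1};d,h) = κ(q^{r+1})`
  have hxi : ∀ r : ℕ, xiA c' D j (q ^ (r + 1)) d h = kappaZ c' D (q ^ (r + 1)) := fun r =>
    stepA_u016_eq_holds c' D j d h q (r + 1) hd hh hq hqh (by omega)
  -- the series
  rw [xiPowSum_eq c' χ j d h s hq.pos]
  have hsplit : ∀ r : ℕ, (v * X) ^ (r + 1) * xiA c' D j (q ^ (r + 1)) d h =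
      ((r : ℂ) + 2) * (v * X) ^ (r + 1) +
        (v * X) ^ (r + 1) * (kappaZ c' D (q ^ (r + 1)) - ((r : ℂ) + 2)) := fun r => by
    rw [hxi r]; ring
  have hE : ∀ r : ℕ, ‖kappaZ c' D (q ^ (r + 1)) - ((r : ℂ) + 2)‖ ≤
      (B * Real.log q) * ((r : ℝ) + 2) ^ 2 := fun r => by
    have h := norm_kappa_prime_pow_sub_le (b1 c' D) (b2 c' D) (b3 c' D) hq (r + 1)
    rw [kappaZ]
    have e1 : (((r + 1 : ℕ) : ℂ) + 1) = (r : ℂ) + 2 := by push_cast; ring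
    rw [e1] at h
    calc _ ≤ ((r + 1 : ℕ) + 1) * (r + 1 : ℕ) * B * Real.log q := h
      _ ≤ (B * Real.log q) * ((r : ℝ) + 2) ^ 2 := by
          push_cast
          have hB0 : 0 ≤ B * Real.log q := by positivity
          nlinarith
  obtain ⟨hsumR, hR⟩ := tsum_pow_succ_mul_bound hvX (by positivity) hE
  have hmain := hasSum_coe_add_two_mul_pow_succ (lt_of_le_of_lt hvX (by norm_num))
  have htot : ∑' r : ℕ, (v * X) ^ (r + 1) * xiA c' D j (q ^ (r + 1)) d h =
      (1 / (1 - v * X) ^ 2 - 1) +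
        ∑' r : ℕ, (v * X) ^ (r + 1) * (kappaZ c' D (q ^ (r + 1)) - ((r : ℂ) + 2)) := by
    rw [tsum_congr hsplit, hmain.summable.tsum_add hsumR, hmain.tsum_eq]
  rw [htot]
  have huA : uA q = u := rfl
  have hvA : vA χ q = v := rfl
  rw [huA, hvA]
  have e : (1 / (1 - v * X) ^ 2 - 1) +
      ∑' r : ℕ, (v * X) ^ (r + 1) * (kappaZ c' D (q ^ (r + 1)) - ((r : ℂ) + 2)) -
      (1 / (1 - v * u) ^ 2 - 1) =
      (1 / (1 - v * X) ^ 2 - 1 / (1 - v * u) ^ 2) +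
        ∑' r : ℕ, (v * X) ^ (r + 1) * (kappaZ c' D (q ^ (r + 1)) - ((r : ℂ) + 2)) := by ring
  rw [e]
  calc _ ≤ ‖1 / (1 - v * X) ^ 2 - 1 / (1 - v * u) ^ 2‖ +
        ‖∑' r : ℕ, (v * X) ^ (r + 1) * (kappaZ c' D (q ^ (r + 1)) - ((r : ℂ) + 2))‖ :=
        norm_add_le _ _
    _ ≤ 125 * ‖v * X - v * u‖ + 90 * (B * Real.log q) * ‖v * X‖ :=
        add_le_add (norm_inv_sq_sub_inv_sq_le hvX hvu) hR
    _ ≤ 125 * (10 * alpha D * Real.log q * (q : ℝ)⁻¹) +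
          90 * ((7 * alpha D) * Real.log q) * (2 * (q : ℝ)⁻¹) := by
        gcongr
    _ = 2510 * (alpha D * Real.log q / q) := by ring
    _ ≤ 2600 * (alpha D * Real.log q / q) := by
        have : 0 ≤ alpha D * Real.log q / q := by positivity
        nlinarith


/-! ## Z22:§A.u019 guard-free (Case 3) -/

/-- **Z22:§A.u019, GUARD-FREE** (App. A p. 103, tex L5081; twin of `Lemma83.stepA_u019_holds` with the unused binder
`AssumptionA D χ` deleted): for `q ∣ d`, `(q,h) = 1`, `|s − 1| < 5α`, `q < D`, `(q,D) = 1`: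
`‖Σ_r χ(q^r)ξ_j(q^r;d,h)/q^{rs} − (1/(1−vu)² − 1 − vu/((1−u)(1−vu)²))‖ ≤ 6700·α log q/q`, all large `D`, every
real primitive `χ` — no hypothesis on `L(1,χ)`. [cite: Zhang2022LandauSiegel, App. A p. 103] -/
theorem stepA_u019_free (c' : ℝ) :
    ∃ C : ℝ, ForAllLarge fun D _ χ => ∀ j ∈ ({1, 2, 3} : Finset ℕ), ∀ d h : ℕ,
      1 ≤ d → 1 ≤ h → ((d * h : ℕ) : ℝ) < bigP D / bigT D ^ 2 → ∀ q : ℕ, q.Prime → ∀ s : ℂ,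
        CondA9 D s q → q ∣ d → Nat.Coprime q h →
          ‖xiPowSum c' χ j d h s q -
              (1 / (1 - vA χ q * uA q) ^ 2 - 1 -
                vA χ q * uA q / ((1 - uA q) * (1 - vA χ q * uA q) ^ 2))‖
            ≤ C * (alpha D * Real.log q / q) := by
  refine ⟨6700, ⌈Real.exp (10 * |c'| * π + 400)⌉₊,
    fun D _ χ hD _ _ j _ d h hd hh _ q hq s hcond hqd hqh => ?_⟩
  have hD' : Real.exp (10 * |c'| * π + 400) ≤ D := le_trans (Nat.le_ceil _) (by exact_mod_cast hD)
  obtain ⟨hℓ3, hα, hB, hαℓ⟩ := largeD_bounds c' hD'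
  obtain ⟨hs, hqD, _⟩ := hcond
  obtain ⟨hXu, hXn, hun, hqinv, hlogq, hlogq0⟩ := frame_X c' hD' hq hqD hs
  set B : ℝ := |b1 c' D| + |b2 c' D| + |b3 c' D| with hBdef
  set v : ℂ := χ (q : ZMod D) with hv
  set X : ℂ := (q : ℂ) ^ (-s) with hX
  set u : ℂ := ((q : ℂ))⁻¹ with hu
  have hq0 : (q : ℂ) ≠ 0 := by exact_mod_cast hq.ne_zero
  have hvn : ‖v‖ ≤ 1 := χ.norm_le_one _
  have hvX : ‖v * X‖ ≤ 3 / 5 := by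
    rw [norm_mul]; nlinarith [norm_nonneg v, norm_nonneg X]
  have hvu : ‖v * u‖ ≤ 3 / 5 := by
    rw [norm_mul]; nlinarith [norm_nonneg v, norm_nonneg u]
  have hvXu : ‖v * X - v * u‖ ≤ 10 * alpha D * Real.log q * (q : ℝ)⁻¹ := by
    rw [← mul_sub, norm_mul]; nlinarith [norm_nonneg v, norm_nonneg (X - u)]
  have hvX2 : ‖v * X‖ ≤ 2 * (q : ℝ)⁻¹ := by
    have h1 : ‖X‖ ≤ ‖X - u‖ + ‖u‖ := by
      have := norm_add_le (X - u) u; rwa [sub_add_cancel] at this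
    have h2 : ‖u‖ = (q : ℝ)⁻¹ := by rw [hu, norm_inv, Complex.norm_natCast]
    have h3 : 10 * alpha D * Real.log q * (q : ℝ)⁻¹ ≤ (q : ℝ)⁻¹ := by
      have : 10 * alpha D * Real.log q ≤ 10 * (alpha D * ell D) := by
        calc _ ≤ 10 * alpha D * ell D := by gcongr
          _ = _ := by ring
      have hq0' : (0 : ℝ) ≤ (q : ℝ)⁻¹ := by positivity
      nlinarith
    calc ‖v * X‖ ≤ ‖X‖ := by rw [norm_mul]; nlinarith [norm_nonneg v, norm_nonneg X]
      _ ≤ 2 * (q : ℝ)⁻¹ := by linarith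
  -- `c₀ = 1/(1−u)` and `w = q^{−β_j}`; `q^{1−β_j}/(q−1) = c₀ w`
  set c₀ : ℂ := 1 / (1 - u) with hc₀
  set w : ℂ := (q : ℂ) ^ (-betaJ c' D j) with hw
  have hu1 : 1 - u ≠ 0 := by
    intro h0
    have : ‖(1 : ℂ)‖ ≤ 1 / 2 := by
      have e : (1 : ℂ) = u := by linear_combination h0
      rw [e]; exact hun
    rw [norm_one] at this; linarith
  have hc₀n : ‖c₀‖ ≤ 2 := by
    have hden : 1 / 2 ≤ ‖1 - u‖ := by
      linarith [norm_le_norm_add_norm_sub' (1 : ℂ) u, norm_one (α := ℂ)]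
    rw [hc₀, norm_div, norm_one, div_le_iff₀ (by positivity)]
    linarith
  have hwn : ‖w‖ = 1 := by
    rw [hw, Complex.norm_natCast_cpow_of_pos hq.pos]
    have : (-betaJ c' D j).re = 0 := by
      rw [Complex.neg_re]; unfold betaJ beta1 beta2 beta3; split_ifs <;> simp
    rw [this, Real.rpow_zero]
  have hw1 : ‖w - 1‖ ≤ B * Real.log q :=
    le_trans (norm_cpow_neg_betaJ_sub_one_le c' D j hq.pos)
      (mul_le_mul_of_nonneg_right (norm_betaJ_le c' D j) hlogq0)
  have hfrac : (q : ℂ) ^ (1 - betaJ c' D j) / ((q : ℂ) - 1) = c₀ * w := by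
    have hq1 : (q : ℂ) - 1 ≠ 0 := by
      have : (1 : ℝ) < q := by exact_mod_cast hq.one_lt
      intro h0
      have h1 : (q : ℂ) = 1 := by linear_combination h0
      have : (q : ℝ) = 1 := by exact_mod_cast h1
      linarith
    rw [sub_eq_add_neg (1 : ℂ), Complex.cpow_add _ _ hq0, Complex.cpow_one, hc₀, hu, hw]
    field_simp
  -- the coefficients and their main terms
  have hxi : ∀ r : ℕ, xiA c' D j (q ^ (r + 1)) d h =
      kappaZ c' D (q ^ (r + 1)) - c₀ * (kappaZ c' D (q ^ r) * w) := fun r => by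
    rw [stepA_u018_eq_corrected c' D j d h q (r + 1) hd hh hq hqd hqh (by omega),
      Nat.add_sub_cancel, mul_div_assoc, hfrac]
    ring
  have hsplit : ∀ r : ℕ, (v * X) ^ (r + 1) * xiA c' D j (q ^ (r + 1)) d h =
      (((r : ℂ) + 2) * (v * X) ^ (r + 1) - c₀ * (((r : ℂ) + 1) * (v * X) ^ (r + 1))) +
        (v * X) ^ (r + 1) * ((kappaZ c' D (q ^ (r + 1)) - ((r : ℂ) + 2)) -
          c₀ * (kappaZ c' D (q ^ r) * w - ((r : ℂ) + 1))) := fun r => by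
    rw [hxi r]; ring
  have hE : ∀ r : ℕ, ‖(kappaZ c' D (q ^ (r + 1)) - ((r : ℂ) + 2)) -
      c₀ * (kappaZ c' D (q ^ r) * w - ((r : ℂ) + 1))‖ ≤
      (3 * B * Real.log q) * ((r : ℝ) + 2) ^ 2 := fun r =>
    case3_coeff_bound (b1 c' D) (b2 c' D) (b3 c' D) hq hc₀n hwn hw1 r
  obtain ⟨hsumR, hR⟩ := tsum_pow_succ_mul_bound hvX (by positivity) hE
  have hlt : ‖v * X‖ < 1 := lt_of_le_of_lt hvX (by norm_num)
  have hmain := (hasSum_coe_add_two_mul_pow_succ hlt).sub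
    ((hasSum_coe_succ_mul_pow_succ hlt).mul_left c₀)
  rw [xiPowSum_eq c' χ j d h s hq.pos]
  have htot : ∑' r : ℕ, (v * X) ^ (r + 1) * xiA c' D j (q ^ (r + 1)) d h =
      ((1 / (1 - v * X) ^ 2 - 1) - c₀ * (v * X / (1 - v * X) ^ 2)) +
        ∑' r : ℕ, (v * X) ^ (r + 1) * ((kappaZ c' D (q ^ (r + 1)) - ((r : ℂ) + 2)) -
          c₀ * (kappaZ c' D (q ^ r) * w - ((r : ℂ) + 1))) := by
    rw [tsum_congr hsplit, hmain.summable.tsum_add hsumR, hmain.tsum_eq]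
  rw [htot]
  have huA : uA q = u := rfl
  have hvA : vA χ q = v := rfl
  rw [huA, hvA]
  have e : ((1 / (1 - v * X) ^ 2 - 1) - c₀ * (v * X / (1 - v * X) ^ 2)) +
      (∑' r : ℕ, (v * X) ^ (r + 1) * ((kappaZ c' D (q ^ (r + 1)) - ((r : ℂ) + 2)) -
          c₀ * (kappaZ c' D (q ^ r) * w - ((r : ℂ) + 1)))) -
      (1 / (1 - v * u) ^ 2 - 1 - v * u / ((1 - u) * (1 - v * u) ^ 2)) =
      (1 / (1 - v * X) ^ 2 - 1 / (1 - v * u) ^ 2) -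
        c₀ * (v * X / (1 - v * X) ^ 2 - v * u / (1 - v * u) ^ 2) +
        ∑' r : ℕ, (v * X) ^ (r + 1) * ((kappaZ c' D (q ^ (r + 1)) - ((r : ℂ) + 2)) -
          c₀ * (kappaZ c' D (q ^ r) * w - ((r : ℂ) + 1))) := by
    have hcW : v * u / ((1 - u) * (1 - v * u) ^ 2) = c₀ * (v * u / (1 - v * u) ^ 2) := by
      rw [hc₀, div_mul_div_comm, one_mul]
    rw [hcW]
    ring
  rw [e]
  calc _ ≤ ‖(1 / (1 - v * X) ^ 2 - 1 / (1 - v * u) ^ 2) -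
          c₀ * (v * X / (1 - v * X) ^ 2 - v * u / (1 - v * u) ^ 2)‖ +
        ‖∑' r : ℕ, (v * X) ^ (r + 1) * ((kappaZ c' D (q ^ (r + 1)) - ((r : ℂ) + 2)) -
          c₀ * (kappaZ c' D (q ^ r) * w - ((r : ℂ) + 1)))‖ := norm_add_le _ _
    _ ≤ (125 * ‖v * X - v * u‖ + 2 * (82 * ‖v * X - v * u‖)) +
          90 * (3 * B * Real.log q) * ‖v * X‖ := by
        refine add_le_add ?_ hR
        calc _ ≤ ‖1 / (1 - v * X) ^ 2 - 1 / (1 - v * u) ^ 2‖ +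
              ‖c₀ * (v * X / (1 - v * X) ^ 2 - v * u / (1 - v * u) ^ 2)‖ := norm_sub_le _ _
          _ ≤ _ := by
              rw [norm_mul]
              exact add_le_add (norm_inv_sq_sub_inv_sq_le hvX hvu)
                (mul_le_mul hc₀n (norm_div_sq_sub_div_sq_le hvX hvu) (norm_nonneg _) (by norm_num))
    _ ≤ (125 * (10 * alpha D * Real.log q * (q : ℝ)⁻¹) +
          2 * (82 * (10 * alpha D * Real.log q * (q : ℝ)⁻¹))) +
          90 * (3 * (7 * alpha D) * Real.log q) * (2 * (q : ℝ)⁻¹) := by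
        gcongr
    _ = 6670 * (alpha D * Real.log q / q) := by ring
    _ ≤ 6700 * (alpha D * Real.log q / q) := by
        have : 0 ≤ alpha D * Real.log q / q := by positivity
        nlinarith


/-! ## (A.2) and (A.3) guard-free -/

/-- **(A.2), GUARD-FREE** (Z22:(A.2), App. A p. 102, tex L5011; the body of `Lemma83.dedA2_holds` run on
`stepA_u017_free`, `stepA_u017_lamTilde_holds`, `stepA_u015_free`, the unused binder `AssumptionA D χ` deleted):
for `q ∣ h`, `|s − 1| < 5α`, `q < D`, `(q,D) = 1`: `‖𝔱_j(d,h,s;q) − 1/(1−vu)‖ ≤ C·α log q/q`, all large `D`,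
every real primitive `χ` — no hypothesis on `L(1,χ)`. Same constant as `eqA_2_holds`.
[cite: Zhang2022LandauSiegel, App. A (A.2) p. 102] -/
theorem eqA_2_free (c' : ℝ) :
    ∃ C : ℝ, ForAllLarge fun D _ χ => ∀ j ∈ ({1, 2, 3} : Finset ℕ), ∀ d h : ℕ,
      1 ≤ d → 1 ≤ h → ((d * h : ℕ) : ℝ) < bigP D / bigT D ^ 2 → ∀ q : ℕ, q.Prime → ∀ s : ℂ,
        CondA9 D s q → q ∣ h →
          ‖frakt c' χ j d h s q - 1 / (1 - vA χ q * uA q)‖ ≤ C * (alpha D * Real.log q / q) := by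
  have hlt : StepA_u017_lamTilde c' := stepA_u017_lamTilde_holds c'
  obtain ⟨C₁, D₁, h₁⟩ := stepA_u017_free c'
  obtain ⟨C₃, D₃, h₃⟩ := stepA_u015_free c'
  refine ⟨|C₃| * (4 + |C₁|) + 3 / 2 * |C₁|, max (max D₁ D₃) ⌈Real.exp (10 * |c'| * π + 400)⌉₊,
    fun D _ χ hD hquad hprim j hj d h hd hh hdh q hq s hcond hqh => ?_⟩
  have hD1 : D₁ ≤ D := le_trans (le_trans (le_max_left _ _) (le_max_left _ _)) hD
  have hD3 : D₃ ≤ D := le_trans (le_trans (le_max_right _ _) (le_max_left _ _)) hD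
  have hD' : Real.exp (10 * |c'| * π + 400) ≤ D :=
    le_trans (Nat.le_ceil _) (by exact_mod_cast le_trans (le_max_right _ _) hD)
  have e17 := h₁ D χ hD1 hquad hprim j hj d h hd hh hdh q hq s hcond hqh
  have e15 := h₃ D χ hD3 hquad hprim j hj q hq s hcond
  have elt := hlt D j d h q hd hq hqh
  obtain ⟨ht0, ht1, hun⟩ := frame_t c' hD' hq hcond.2.1
  set t : ℝ := alpha D * Real.log q / q with htdef
  set v : ℂ := vA χ q with hv
  set u : ℂ := uA q with hu
  have hvn : ‖v‖ ≤ 1 := χ.norm_le_one _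
  have hun' : ‖u‖ ≤ 1 / 2 := hun
  have hvu : ‖v * u‖ ≤ 1 / 2 := by rw [norm_mul]; nlinarith [norm_nonneg v, norm_nonneg u]
  have hden : 1 / 2 ≤ ‖1 - v * u‖ := by
    linarith [norm_le_norm_add_norm_sub' (1 : ℂ) (v * u), norm_one (α := ℂ)]
  have hden0 : 1 - v * u ≠ 0 := fun h0 => by rw [h0, norm_zero] at hden; linarith
  set P : ℂ := 1 - v * u with hP
  set M : ℂ := 1 / (1 - v * u) ^ 2 with hM
  have hPn : ‖P‖ ≤ 3 / 2 := by
    calc ‖P‖ ≤ ‖(1 : ℂ)‖ + ‖v * u‖ := norm_sub_le _ _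
      _ ≤ 3 / 2 := by rw [norm_one]; linarith
  have hMn : ‖M‖ ≤ 4 := by
    rw [hM, norm_div, norm_one, norm_pow, div_le_iff₀ (by positivity)]
    nlinarith [pow_le_pow_left₀ (by norm_num : (0:ℝ) ≤ 1 / 2) hden 2]
  have hPM : P * M = 1 / (1 - v * u) := by rw [hP, hM]; field_simp
  -- the two estimates
  have e15' : ‖pref c' χ j s q - P‖ ≤ |C₃| * t :=
    le_trans e15 (by rw [htdef]; exact mul_le_mul_of_nonneg_right (le_abs_self _) ht0)
  have e17' : ‖xiPowSum c' χ j d h s q - (M - 1)‖ ≤ |C₁| * t :=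
    le_trans e17 (by rw [htdef]; exact mul_le_mul_of_nonneg_right (le_abs_self _) ht0)
  have hS : ‖1 + xiPowSum c' χ j d h s q‖ ≤ 4 + |C₁| := by
    have e : 1 + xiPowSum c' χ j d h s q = (xiPowSum c' χ j d h s q - (M - 1)) + M := by ring
    rw [e]
    calc _ ≤ ‖xiPowSum c' χ j d h s q - (M - 1)‖ + ‖M‖ := norm_add_le _ _
      _ ≤ |C₁| * t + 4 := add_le_add e17' hMn
      _ ≤ 4 + |C₁| := by nlinarith [abs_nonneg C₁]
  -- assemble
  unfold frakt
  rw [elt, one_mul, ← hPM]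
  have e : pref c' χ j s q * (1 + xiPowSum c' χ j d h s q) - P * M =
      (pref c' χ j s q - P) * (1 + xiPowSum c' χ j d h s q) +
        P * (xiPowSum c' χ j d h s q - (M - 1)) := by ring
  rw [e]
  calc _ ≤ ‖(pref c' χ j s q - P) * (1 + xiPowSum c' χ j d h s q)‖ +
        ‖P * (xiPowSum c' χ j d h s q - (M - 1))‖ := norm_add_le _ _
    _ ≤ |C₃| * t * (4 + |C₁|) + 3 / 2 * (|C₁| * t) := by
        rw [norm_mul, norm_mul]
        exact add_le_add (mul_le_mul e15' hS (norm_nonneg _) (by positivity))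
          (mul_le_mul hPn e17' (norm_nonneg _) (by norm_num))
    _ = (|C₃| * (4 + |C₁|) + 3 / 2 * |C₁|) * (alpha D * Real.log q / q) := by rw [htdef]; ring


/-- **(A.3), GUARD-FREE** (Z22:(A.3), App. A p. 102, tex L5015; the body of `Lemma83.dedA3_holds` run on
`stepA_u019_free`, `stepA_u018_lamTilde_holds`, `stepA_u015_free`, the unused binder `AssumptionA D χ` deleted):
for `q ∣ d`, `(q,h) = 1`, `|s − 1| < 5α`, `q < D`, `(q,D) = 1`:
`‖𝔱_j(d,h,s;q) − (1−u−vu)/((1−vu)(1−u))‖ ≤ C·α log q/q`, all large `D`, every real primitive `χ` — no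
hypothesis on `L(1,χ)`. Same constant as `eqA_3_holds`. [cite: Zhang2022LandauSiegel, App. A (A.3) p. 102] -/
theorem eqA_3_free (c' : ℝ) :
    ∃ C : ℝ, ForAllLarge fun D _ χ => ∀ j ∈ ({1, 2, 3} : Finset ℕ), ∀ d h : ℕ,
      1 ≤ d → 1 ≤ h → ((d * h : ℕ) : ℝ) < bigP D / bigT D ^ 2 → ∀ q : ℕ, q.Prime → ∀ s : ℂ,
        CondA9 D s q → q ∣ d → Nat.Coprime q h →
          ‖frakt c' χ j d h s q - (1 - uA q - vA χ q * uA q) / ((1 - vA χ q * uA q) * (1 - uA q))‖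
            ≤ C * (alpha D * Real.log q / q) := by
  have hlt : StepA_u018_lamTilde c' := stepA_u018_lamTilde_holds c'
  obtain ⟨C₁, D₁, h₁⟩ := stepA_u019_free c'
  obtain ⟨C₃, D₃, h₃⟩ := stepA_u015_free c'
  refine ⟨|C₃| * (8 + |C₁|) + 3 / 2 * |C₁|, max (max D₁ D₃) ⌈Real.exp (10 * |c'| * π + 400)⌉₊,
    fun D _ χ hD hquad hprim j hj d h hd hh hdh q hq s hcond hqd hqh => ?_⟩
  have hD1 : D₁ ≤ D := le_trans (le_trans (le_max_left _ _) (le_max_left _ _)) hD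
  have hD3 : D₃ ≤ D := le_trans (le_trans (le_max_right _ _) (le_max_left _ _)) hD
  have hD' : Real.exp (10 * |c'| * π + 400) ≤ D :=
    le_trans (Nat.le_ceil _) (by exact_mod_cast le_trans (le_max_right _ _) hD)
  have e19 := h₁ D χ hD1 hquad hprim j hj d h hd hh hdh q hq s hcond hqd hqh
  have e15 := h₃ D χ hD3 hquad hprim j hj q hq s hcond
  have elt := hlt D j d h q hh hq hqd
  obtain ⟨ht0, ht1, hun⟩ := frame_t c' hD' hq hcond.2.1
  set t : ℝ := alpha D * Real.log q / q with htdef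
  set v : ℂ := vA χ q with hv
  set u : ℂ := uA q with hu
  have hvn : ‖v‖ ≤ 1 := χ.norm_le_one _
  have hun' : ‖u‖ ≤ 1 / 2 := hun
  have hvu : ‖v * u‖ ≤ 1 / 2 := by rw [norm_mul]; nlinarith [norm_nonneg v, norm_nonneg u]
  have hden : 1 / 2 ≤ ‖1 - v * u‖ := by
    linarith [norm_le_norm_add_norm_sub' (1 : ℂ) (v * u), norm_one (α := ℂ)]
  have hden0 : 1 - v * u ≠ 0 := fun h0 => by rw [h0, norm_zero] at hden; linarith
  have hdenu : 1 / 2 ≤ ‖1 - u‖ := by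
    linarith [norm_le_norm_add_norm_sub' (1 : ℂ) u, norm_one (α := ℂ)]
  have hdenu0 : 1 - u ≠ 0 := fun h0 => by rw [h0, norm_zero] at hdenu; linarith
  set P : ℂ := 1 - v * u with hP
  set M : ℂ := 1 / (1 - v * u) ^ 2 - v * u / ((1 - u) * (1 - v * u) ^ 2) with hM
  have hPn : ‖P‖ ≤ 3 / 2 := by
    calc ‖P‖ ≤ ‖(1 : ℂ)‖ + ‖v * u‖ := norm_sub_le _ _
      _ ≤ 3 / 2 := by rw [norm_one]; linarith
  have hMn : ‖M‖ ≤ 8 := by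
    have h1 : ‖1 / (1 - v * u) ^ 2‖ ≤ 4 := by
      rw [norm_div, norm_one, norm_pow, div_le_iff₀ (by positivity)]
      nlinarith [pow_le_pow_left₀ (by norm_num : (0:ℝ) ≤ 1 / 2) hden 2]
    have h2 : ‖v * u / ((1 - u) * (1 - v * u) ^ 2)‖ ≤ 4 := by
      have hd : 1 / 8 ≤ ‖(1 - u) * (1 - v * u) ^ 2‖ := by
        rw [norm_mul, norm_pow]
        have := mul_le_mul hdenu (pow_le_pow_left₀ (by norm_num : (0:ℝ) ≤ 1 / 2) hden 2)
          (by positivity) (norm_nonneg _)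
        linarith
      rw [norm_div, div_le_iff₀ (by positivity)]
      linarith
    calc ‖M‖ ≤ ‖1 / (1 - v * u) ^ 2‖ + ‖v * u / ((1 - u) * (1 - v * u) ^ 2)‖ := norm_sub_le _ _
      _ ≤ 8 := by linarith
  have hPM : P * M = (1 - u - v * u) / ((1 - v * u) * (1 - u)) := by
    rw [hP, hM]; field_simp
  have e15' : ‖pref c' χ j s q - P‖ ≤ |C₃| * t :=
    le_trans e15 (by rw [htdef]; exact mul_le_mul_of_nonneg_right (le_abs_self _) ht0)
  have e19' : ‖xiPowSum c' χ j d h s q - (M - 1)‖ ≤ |C₁| * t := by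
    have e : M - 1 = 1 / (1 - v * u) ^ 2 - 1 - v * u / ((1 - u) * (1 - v * u) ^ 2) := by
      rw [hM]; ring
    rw [e]
    exact le_trans e19 (by rw [htdef]; exact mul_le_mul_of_nonneg_right (le_abs_self _) ht0)
  have hS : ‖1 + xiPowSum c' χ j d h s q‖ ≤ 8 + |C₁| := by
    have e : 1 + xiPowSum c' χ j d h s q = (xiPowSum c' χ j d h s q - (M - 1)) + M := by ring
    rw [e]
    calc _ ≤ ‖xiPowSum c' χ j d h s q - (M - 1)‖ + ‖M‖ := norm_add_le _ _
      _ ≤ |C₁| * t + 8 := add_le_add e19' hMn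
      _ ≤ 8 + |C₁| := by nlinarith [abs_nonneg C₁]
  unfold frakt
  rw [elt, one_mul, ← hPM]
  have e : pref c' χ j s q * (1 + xiPowSum c' χ j d h s q) - P * M =
      (pref c' χ j s q - P) * (1 + xiPowSum c' χ j d h s q) +
        P * (xiPowSum c' χ j d h s q - (M - 1)) := by ring
  rw [e]
  calc _ ≤ ‖(pref c' χ j s q - P) * (1 + xiPowSum c' χ j d h s q)‖ +
        ‖P * (xiPowSum c' χ j d h s q - (M - 1))‖ := norm_add_le _ _
    _ ≤ |C₃| * t * (8 + |C₁|) + 3 / 2 * (|C₁| * t) := by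
        rw [norm_mul, norm_mul]
        exact add_le_add (mul_le_mul e15' hS (norm_nonneg _) (by positivity))
          (mul_le_mul hPn e19' (norm_nonneg _) (by norm_num))
    _ = (|C₃| * (8 + |C₁|) + 3 / 2 * |C₁|) * (alpha D * Real.log q / q) := by rw [htdef]; ring

end Literature.NumberTheory.LFunctions.Zhang2022.Repair.Gap

end
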